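import Mathlib
import Literature.NumberTheory.Sieve.FordMaynardSieveBoundG1
import Literature.NumberTheory.Sieve.FordMaynardTypeIBound

/-!
# Route `FordMaynardSieveConst01651`, target `SieveConst01651` (stmt-Parity-19185), line `sieve_decomposition`:
# the piece decomposition behind the registered stub `stub_hkPieces` (pure convex geometry of the cone data)

K. Ford, J. Maynard, *On the theory of prime producing sieves*, arXiv:2407.14368, §6.2 / §7.2: the comparison of the
prime `k`-tuple sum of the main-term weight `h_k = 𝟙[vᵢ > ν ∀ i]·(𝟙⋆g)` with its integral (the tree's
`abs_primeTupleSum_mainG_sub_integral_le`) wants `h_k`, in every dimension, as an EXACT finite sum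
`∑ⱼ cⱼ·𝟙[Pcⱼ]` of constants times indicators of convex measurable sets.  For `g` symmetric and piecewise constant on
convex polytopes of the ordered cone (`IsPiecewiseConstOnCone`) this is elementary convex geometry, proved here:

* `sortChamber σ`-free formulation: the STABLE-SORTING CHAMBERS `{v | σ = Tuple.sort v}`
  (`= {v | v ∘ σ monotone, ties broken by index}`, Mathlib `Tuple.eq_sort_iff`) are convex and measurable and
  partition `ℝ^r` (`convex_setOf_eq_sort`, `measurableSet_setOf_eq_sort`);
* `apply_dim_pieces`: `g_r = ∑_{σ, j} cⱼ·𝟙[{σ = sort} ∩ (· ∘ σ)⁻¹ Pⱼ]` pointwise (symmetry moves `v` to `v ∘ sort v`,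
  which is monotone, where the cone representation applies);
* `starSum_pieces`: `(𝟙⋆g)_m = ∑_A` pull-backs of the pieces of `g_{|A|}` under the linear coordinate projections
  `v ↦ v_A`;
* `starSum_box_pieces`: the same after multiplication by the indicator of the convex box `{vᵢ > ν ∀ i}` — this is
  `hfun ν g k k` of the line's skeleton, and `hfun ν g k m = 0` for `m ≠ k`; the registered stub follows in five lines
  (by-name file `…SieveConst01651StubHkPieces`).

Pure bookkeeping (no primes); closing one stub of one line advances one leaf; nothing here proves the Parity summit.
-/

noncomputable section

open Finset MeasureTheory Set
open scoped Classical
open Literature.NumberTheory.Sieve Literature.NumberTheory.Sieve.FordMaynard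

namespace Summit.Parity.GeneralizedHardyLittlewood.FordMaynardSieveConst01651SieveConst01651

/-! ### Re-indexing a finite family of pieces by `Fin n` -/

/-- A representation `F = ∑_{i : ι} cᵢ·𝟙[Pcᵢ]` over any finite index type re-indexes to one over `Fin n`. [folklore] -/
theorem pieces_of_fintype {m : ℕ} {ι : Type*} [Fintype ι] (F : (Fin m → ℝ) → ℝ)
    (Pc : ι → Set (Fin m → ℝ)) (c : ι → ℝ) (hPc : ∀ i, Convex ℝ (Pc i) ∧ MeasurableSet (Pc i))
    (hF : ∀ v, F v = ∑ i, if v ∈ Pc i then c i else 0) :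
    ∃ (n : ℕ) (Pc' : Fin n → Set (Fin m → ℝ)) (c' : Fin n → ℝ),
      (∀ j, Convex ℝ (Pc' j) ∧ MeasurableSet (Pc' j)) ∧ ∀ v, F v = ∑ j, if v ∈ Pc' j then c' j else 0 := by
  refine ⟨Fintype.card ι, fun j => Pc ((Fintype.equivFin ι).symm j), fun j => c ((Fintype.equivFin ι).symm j),
    fun j => hPc _, fun v => ?_⟩
  rw [hF v]
  exact ((Fintype.equivFin ι).symm.sum_comp (fun i => if v ∈ Pc i then c i else 0)).symm

/-! ### Stable-sorting chambers -/

/-- The stable-sorting chamber of `σ`: `σ = Tuple.sort v` iff `v ∘ σ` is monotone with ties broken by the index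
(Mathlib `Tuple.eq_sort_iff`). [folklore] -/
theorem mem_setOf_eq_sort_iff {r : ℕ} (σ : Equiv.Perm (Fin r)) (v : Fin r → ℝ) :
    v ∈ {v : Fin r → ℝ | σ = Tuple.sort v} ↔
      Monotone (v ∘ σ) ∧ ∀ i j, i < j → v (σ i) = v (σ j) → σ i < σ j := by
  rw [Set.mem_setOf_eq, Tuple.eq_sort_iff]

/-- Stable-sorting chambers are convex. [folklore] -/
theorem convex_setOf_eq_sort {r : ℕ} (σ : Equiv.Perm (Fin r)) :
    Convex ℝ {v : Fin r → ℝ | σ = Tuple.sort v} := by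
  intro x hx y hy a b ha hb hab
  rw [mem_setOf_eq_sort_iff] at hx hy ⊢
  refine ⟨fun i j hij => ?_, fun i j hij hfij => ?_⟩
  · simp only [Function.comp_apply, Pi.add_apply, Pi.smul_apply, smul_eq_mul]
    exact add_le_add (mul_le_mul_of_nonneg_left (hx.1 hij) ha) (mul_le_mul_of_nonneg_left (hy.1 hij) hb)
  · simp only [Pi.add_apply, Pi.smul_apply, smul_eq_mul] at hfij
    have hxle : x (σ i) ≤ x (σ j) := hx.1 hij.le
    have hyle : y (σ i) ≤ y (σ j) := hy.1 hij.le
    rcases ha.eq_or_lt with ha0 | ha0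
    · have hb1 : b = 1 := by linarith
      subst hb1
      rw [← ha0] at hfij
      simp only [zero_mul, zero_add, one_mul] at hfij
      exact hy.2 i j hij hfij
    · have h1 : a * x (σ i) ≤ a * x (σ j) := mul_le_mul_of_nonneg_left hxle ha
      have h2 : b * y (σ i) ≤ b * y (σ j) := mul_le_mul_of_nonneg_left hyle hb
      have heq : a * x (σ i) = a * x (σ j) := le_antisymm h1 (by linarith)
      exact hx.2 i j hij (mul_left_cancel₀ ha0.ne' heq)

/-- Stable-sorting chambers are measurable. [folklore] -/
theorem measurableSet_setOf_eq_sort {r : ℕ} (σ : Equiv.Perm (Fin r)) :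
    MeasurableSet {v : Fin r → ℝ | σ = Tuple.sort v} := by
  have hset : {v : Fin r → ℝ | σ = Tuple.sort v} =
      (⋂ i, ⋂ j, {v : Fin r → ℝ | i ≤ j → v (σ i) ≤ v (σ j)}) ∩
        ⋂ i, ⋂ j, {v : Fin r → ℝ | i < j → v (σ i) = v (σ j) → σ i < σ j} := by
    ext v
    rw [mem_setOf_eq_sort_iff]
    simp [Monotone, Set.mem_iInter]
  rw [hset]
  refine MeasurableSet.inter (MeasurableSet.iInter fun (i : Fin r) => MeasurableSet.iInter fun (j : Fin r) => ?_)
    (MeasurableSet.iInter fun (i : Fin r) => MeasurableSet.iInter fun (j : Fin r) => ?_)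
  · by_cases hij : i ≤ j
    · simp only [hij, true_implies]
      exact measurableSet_le (measurable_pi_apply _) (measurable_pi_apply _)
    · simp [hij]
  · by_cases hij : i < j
    · by_cases hs : σ i < σ j
      · simp [hs]
      · have h1 : Measurable fun v : Fin r → ℝ => v (σ i) := measurable_pi_apply _
        have h2 : Measurable fun v : Fin r → ℝ => v (σ j) := measurable_pi_apply _
        convert (measurableSet_eq_fun h1 h2).compl using 1
        ext v
        simp [hij, hs]
    · simp [hij]

/-! ### One dimension: `g_r` as a sum of constants on convex measurable pieces -/

/-- **`g_r = ∑ⱼ cⱼ·𝟙[Pcⱼ]` exactly**, with convex measurable `Pcⱼ ⊆ ℝ^r`, for `g` symmetric and piecewise constant on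
convex polytopes of the ordered cone: the pieces are `{σ = sort} ∩ (· ∘ σ)⁻¹ Pⱼ` over (permutation, cone piece).
[cite: FordMaynard2024PrimeSieves, Definition 7.2 (sub-class) and §6.2] -/
theorem apply_dim_pieces {g : VecFn} (hs : g.IsSymmetric) (hpc : IsPiecewiseConstOnCone g) (r : ℕ) :
    ∃ (n : ℕ) (Pc : Fin n → Set (Fin r → ℝ)) (c : Fin n → ℝ),
      (∀ j, Convex ℝ (Pc j) ∧ MeasurableSet (Pc j)) ∧ ∀ v, g r v = ∑ j, if v ∈ Pc j then c j else 0 := by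
  obtain ⟨n, P, c, hP, hg⟩ := hpc r
  refine pieces_of_fintype (ι := Equiv.Perm (Fin r) × Fin n) (g r)
    (fun p => {v : Fin r → ℝ | p.1 = Tuple.sort v} ∩ (fun v : Fin r → ℝ => v ∘ ⇑p.1) ⁻¹' P p.2)
    (fun p => c p.2) (fun p => ⟨?_, ?_⟩) (fun v => ?_)
  · refine (convex_setOf_eq_sort p.1).inter ?_
    have hlin : (fun v : Fin r → ℝ => v ∘ ⇑p.1) = ⇑(LinearMap.funLeft ℝ ℝ ⇑p.1) := by
      funext v; ext i; simp [LinearMap.funLeft_apply]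
    rw [hlin]
    exact (hP p.2).1.convex.linear_preimage _
  · exact (measurableSet_setOf_eq_sort p.1).inter
      ((measurable_pi_lambda _ fun i => measurable_pi_apply (p.1 i)) (hP p.2).1.measurableSet)
  · rw [Fintype.sum_prod_type]
    simp only [Set.mem_inter_iff, Set.mem_setOf_eq, Set.mem_preimage]
    rw [Finset.sum_eq_single (Tuple.sort v)]
    · simp only [true_and]
      rw [← hs r (Tuple.sort v) v, hg _ (Tuple.monotone_sort v)]
    · intro σ _ hσ
      refine Finset.sum_eq_zero fun j _ => ?_
      rw [if_neg]
      exact fun h => hσ h.1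
    · intro h; exact absurd (Finset.mem_univ _) h

/-! ### `(𝟙⋆g)_m` and the boxed main-term weight -/

/-- **`(𝟙⋆g)_m = ∑ⱼ cⱼ·𝟙[Pcⱼ]` exactly** with convex measurable pieces: pull back the pieces of each `g_{|A|}` along the
linear coordinate projection `v ↦ v_A`. [cite: FordMaynard2024PrimeSieves, Definition 7.1 and §6.2] -/
theorem starSum_pieces {g : VecFn} (hs : g.IsSymmetric) (hpc : IsPiecewiseConstOnCone g) (m : ℕ) :
    ∃ (n : ℕ) (Pc : Fin n → Set (Fin m → ℝ)) (c : Fin n → ℝ),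
      (∀ j, Convex ℝ (Pc j) ∧ MeasurableSet (Pc j)) ∧ ∀ v, starSum g m v = ∑ j, if v ∈ Pc j then c j else 0 := by
  choose n Pc c hPc hg using fun r => apply_dim_pieces hs hpc r
  refine pieces_of_fintype (ι := Σ A : Finset (Fin m), Fin (n A.card)) (starSum g m)
    (fun p => (fun v : Fin m → ℝ => fun i => v (p.1.orderEmbOfFin rfl i)) ⁻¹' Pc p.1.card p.2)
    (fun p => c p.1.card p.2) (fun p => ⟨?_, ?_⟩) (fun v => ?_)
  · have hlin : (fun v : Fin m → ℝ => fun i => v (p.1.orderEmbOfFin rfl i)) =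
        ⇑(LinearMap.funLeft ℝ ℝ ⇑(p.1.orderEmbOfFin rfl)) := by
      funext v; ext i; simp [LinearMap.funLeft_apply]
    rw [hlin]
    exact (hPc p.1.card p.2).1.linear_preimage _
  · exact (measurable_pi_lambda _ fun i => measurable_pi_apply _) (hPc p.1.card p.2).2
  · unfold starSum
    rw [Fintype.sum_sigma]
    refine Finset.sum_congr rfl fun A _ => ?_
    rw [hg A.card]
    rfl

/-- **The boxed weight `𝟙[vᵢ > ν ∀ i]·(𝟙⋆g)_m = ∑ⱼ cⱼ·𝟙[Pcⱼ]` exactly** with convex measurable pieces (intersect each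
piece with the convex box): the `hsum`/`hpc` input of the tree's `abs_primeTupleSum_mainG_sub_integral_le` for the
main-term weight `h_k` of Ford–Maynard Lemma 7.20. [cite: FordMaynard2024PrimeSieves, §6.2 and Lemma 7.20] -/
theorem starSum_box_pieces {g : VecFn} (hs : g.IsSymmetric) (hpc : IsPiecewiseConstOnCone g) (ν : ℝ) (m : ℕ) :
    ∃ (n : ℕ) (Pc : Fin n → Set (Fin m → ℝ)) (c : Fin n → ℝ),
      (∀ j, Convex ℝ (Pc j) ∧ MeasurableSet (Pc j)) ∧
      ∀ v, (if ∀ i, ν < v i then starSum g m v else 0) = ∑ j, if v ∈ Pc j then c j else 0 := by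
  obtain ⟨n, Pc, c, hPc, hg⟩ := starSum_pieces hs hpc m
  have hBc : Convex ℝ {v : Fin m → ℝ | ∀ i, ν < v i} := by
    have : {v : Fin m → ℝ | ∀ i, ν < v i} = ⋂ i, {v | ν < v i} := by ext v; simp [Set.mem_iInter]
    rw [this]
    exact convex_iInter fun i => convex_halfSpace_gt (IsLinearMap.mk (fun x y => rfl) fun a x => rfl) ν
  have hBm : MeasurableSet {v : Fin m → ℝ | ∀ i, ν < v i} := by
    have : {v : Fin m → ℝ | ∀ i, ν < v i} = ⋂ i, {v | ν < v i} := by ext v; simp [Set.mem_iInter]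
    rw [this]
    exact MeasurableSet.iInter fun i => measurableSet_lt measurable_const (measurable_pi_apply i)
  refine ⟨n, fun j => {v | ∀ i, ν < v i} ∩ Pc j, c, fun j => ⟨hBc.inter (hPc j).1, hBm.inter (hPc j).2⟩,
    fun v => ?_⟩
  by_cases hv : ∀ i, ν < v i
  · rw [if_pos hv, hg v]
    refine Finset.sum_congr rfl fun j _ => ?_
    simp [hv]
  · rw [if_neg hv]
    symm
    refine Finset.sum_eq_zero fun j _ => ?_
    simp [hv]

end Summit.Parity.GeneralizedHardyLittlewood.FordMaynardSieveConst01651SieveConst01651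

end
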